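import Summits.CriticalPhenomena.PercolationContinuityZ3.Theorems.PercNearOneGluingNoHeavyLowerTailMajorityGluingHubOnlyWeak
import HarnessLib

/-!
# Majority gluing with loss `2·max` from the weak percolation-EKR bound — NON-VACUOUS (repaired) conditional
# (lane prim-rate; audit seat 3 gen 7 repair of p312163's hypothesis; proof = constants-miner 1's p312163 verbatim)

Support file for the closed crux `NoHeavyLowerTail` (stmt-CriticalPhenomena-4575; `--supports … --as helper`).
`HubOnly.majorityGluing_two_of_weakPercEKR` (p312163, `…MajorityGluingHubOnlyWeak.lean:48`) takes a ∀-hypothesis `hWEKR` over all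
`δ ≤ 1/2` and all relay sets `T` with no `0 ≤ δ` guard; that hypothesis is false at `T = ∅, δ = -1`
(`HubOnly.not_weakPercEKR_asTyped`), so p312163 is vacuous as typed.  Here the SAME theorem is stated with `0 ≤ δ →` inserted in the
hypothesis — the row M1-E1w of `run/shared/lean/prim/prim-rate/prim-rate-mine-1/CANDIDATES.md` §GEN-2 as intended (for non-empty `T`
the guard is automatic) — and proved by p312163's argument unchanged: the hypothesis is used once, at `δ := max_{a∈A} μ(a ↮ a₀) ≥ 0`.
Theorems only, no definitions, no sorries, standard axioms. [cite: KozmaNitzan2024, Conj. 1 (p. 3), Conj. 4 (p. 32)]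
-/

noncomputable section

namespace Summit.CriticalPhenomena.PercolationContinuityZ3.Theorems

open MeasureTheory Set
open Literature.Probability.LatticeModels (prodBernoulli)
open Literature.Probability.Percolation
open scoped Classical

namespace HubOnly

/-- **REPAIRED (non-vacuous) form of `HubOnly.majorityGluing_two_of_weakPercEKR` (p312163)**: the weak percolation-EKR hypothesis now
carries `0 ≤ δ` (without it the hypothesis is refutable at `T = ∅`, `δ = -1` — `HubOnly.not_weakPercEKR_asTyped`,
`…MajorityGluingHubOnlyWeakAsTyped.lean` — and p312163 holds vacuously).  The proof is p312163's proof VERBATIM (constants-miner 1,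
gen 2) with `hM0 : 0 ≤ M` passed at the single instantiation `δ := M = max_{a∈A} μ(a ↮ a₀)`; so this is the kernel form of
«row M1-E1w (0 ≤ δ ≤ 1/2) ⟹ row M1-L2 with loss 2·max, every |A|».  ORIGINAL DOCSTRING OF p312163 FOLLOWS.
**MAJORITY GLUING WITH LOSS `2·max` FOR EVERY `|A|`, FROM THE WEAK (BALLOT-TYPE) PERCOLATION EKR BOUND** — the weakest hub-only input
that suffices (prim-rate row M1-E1w).  HYPOTHESIS (non-degenerate weights): for a hub `a₀ ∉ T`, `|T| < 2h`, `δ ≤ 1/2` and `μ(v ↮ a₀) ≤ δ` on `T`,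
`μ(h ≤ #{v ∈ T : v ↮ a₀}) ≤ δ/(1 − δ)` — for INDEPENDENT cuts this is Frankl's shifted random-walk (ballot) bound `μ_p(𝓕) ≤ p/(1−p)` for an
intersecting family, weaker than the biased Erdős–Ko–Rado bound `p`.  CONCLUSION: `μ(o ↔ a₀ ∧ 2N > |A|) ≥ μ(o ↔ A) − 2·max_{a∈A} μ(a ↮ a₀)` for every
relay set, hub, observer and weight function.  Proof: with `M = max`, if `M > 1/2` the bound is trivial; otherwise
`H_a ⊆ {a ↮ a₀} ∪ ({a ↔ a₀} ∩ {h ≤ #cut(A ∖ {a₀,a})})`, Harris (increasing × decreasing) bounds the second piece by `(1 − δ_a)·M/(1−M)`, and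
`δ_a + (1 − δ_a)·M/(1−M) ≤ M + (1−M)·M/(1−M) = 2M`. [cite: KozmaNitzan2024, Conj. 1 (p. 3), Conj. 4 (p. 32)] -/
theorem majorityGluing_two_of_weakPercEKR_of_nonneg
    (hWEKR : ∀ (n : ℕ) (p : Sym2 (Fin n) → unitInterval), (∀ e, 0 < p e ∧ p e < 1) →
      ∀ (T : Finset (Fin n)) (a₀ : Fin n) (h : ℕ) (δ : ℝ), a₀ ∉ T → T.card < 2 * h → δ ≤ 1 / 2 → 0 ≤ δ →
      (∀ v ∈ T, (prodBernoulli p).real (openConn v a₀ : Set (BondConfig (Fin n)))ᶜ ≤ δ) →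
      (prodBernoulli p).real {ω : BondConfig (Fin n) | h ≤ (T.filter fun v => ω ∉ openConn v a₀).card} ≤ δ / (1 - δ))
    (n : ℕ) (w : Sym2 (Fin n) → unitInterval) (A : Finset (Fin n)) (o a₀ : Fin n) (δ₀ : ℝ)
    (ha₀ : a₀ ∈ A) (hδ₀ : ∀ a ∈ A, (prodBernoulli w).real (openConn a a₀ : Set (BondConfig (Fin n)))ᶜ ≤ δ₀) :
    (prodBernoulli w).real (⋃ a ∈ A, openConn o a) - 2 * δ₀ ≤
      (prodBernoulli w).real {ω : BondConfig (Fin n) | ω ∈ openConn o a₀ ∧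
          A.card < 2 * (A.filter fun a => ω ∈ openConn o a).card} := by
  have h := majorityGluing_of_hubOnly (n := n) 2 zero_le_two A a₀ ha₀ ?_ w o δ₀ hδ₀
  · linarith
  intro p hp a ha
  set μ := prodBernoulli p with hμ
  have hms : ∀ S : Set (BondConfig (Fin n)), MeasurableSet S := fun _ => MeasurableSet.of_discrete
  set δ : Fin n → ℝ := fun x => μ.real (openConn x a₀ : Set (BondConfig (Fin n)))ᶜ with hδ
  set M := A.sup' ⟨a₀, ha₀⟩ δ with hM
  have hδle : ∀ x ∈ A, δ x ≤ M := fun x hx => Finset.le_sup' δ hx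
  have hM0 : 0 ≤ M := le_trans measureReal_nonneg (hδle a₀ ha₀)
  set H : Set (BondConfig (Fin n)) := {ω | ω ∈ openConn a a₀ →
      2 * (A.filter fun a' => ω ∈ openConn a' a₀).card ≤ A.card} with hH
  by_cases hbig : 1 / 2 < M
  · have : μ.real H ≤ 1 := measureReal_le_one
    linarith
  have hbig' : M ≤ 1 / 2 := not_lt.1 hbig
  set T : Finset (Fin n) := (A.erase a₀).erase a with hT
  set hh : ℕ := (A.card + 1) / 2 with hhh
  have hTA : T ⊆ A := (Finset.erase_subset _ _).trans (Finset.erase_subset _ _)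
  have ha₀T : a₀ ∉ T := fun h' => Finset.ne_of_mem_erase (Finset.mem_of_mem_erase h') rfl |>.elim
  set K : Set (BondConfig (Fin n)) := {ω | hh ≤ (T.filter fun v => ω ∉ openConn v a₀).card} with hK
  -- `H ⊆ {a ↮ a₀} ∪ ({a ↔ a₀} ∩ K)`
  have hsub : H ⊆ (openConn a a₀ : Set (BondConfig (Fin n)))ᶜ ∪ ((openConn a a₀ : Set (BondConfig (Fin n))) ∩ K) := by
    intro ω hω
    by_cases haa : ω ∈ openConn a a₀
    · right
      refine ⟨haa, ?_⟩
      have hle := hω haa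
      have hsplit := Finset.card_filter_add_card_filter_not (s := A) (fun a' => ω ∈ openConn a' a₀)
      have hcut : (A.filter fun a' => ω ∉ openConn a' a₀) ⊆ T.filter fun v => ω ∉ openConn v a₀ := by
        intro x hx
        rw [Finset.mem_filter] at hx ⊢
        refine ⟨?_, hx.2⟩
        rw [hT, Finset.mem_erase, Finset.mem_erase]
        refine ⟨?_, ?_, hx.1⟩
        · rintro rfl; exact hx.2 haa
        · rintro rfl; exact hx.2 (SimpleGraph.Reachable.refl _ : (openGraph ω).Reachable x x)
      have hc := Finset.card_le_card hcut
      simp only [hK, mem_setOf_eq]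
      omega
    · left; exact haa
  have hTcard : T.card < 2 * hh := by
    have h1 : T.card + 1 ≤ A.card := by
      have e1 := Finset.card_erase_of_mem ha₀
      have h2 : T.card ≤ (A.erase a₀).card := Finset.card_le_card (Finset.erase_subset _ _)
      have hk : 1 ≤ A.card := Finset.card_pos.2 ⟨a₀, ha₀⟩
      omega
    have hk2 : A.card ≤ 2 * hh := by rw [hhh]; omega
    omega
  -- the weak EKR bound for `K`, and Harris for `{a ↔ a₀} ∩ K`
  have hKb : μ.real K ≤ M / (1 - M) :=
    hWEKR n p hp T a₀ hh M ha₀T hTcard hbig' hM0 (fun v hv => hδle v (hTA hv))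
  have hHarris : μ.real ((openConn a a₀ : Set (BondConfig (Fin n))) ∩ K) ≤
      μ.real (openConn a a₀ : Set (BondConfig (Fin n))) * μ.real K :=
    Literature.Probability.LatticeModels.prodBernoulli_harris_upper_lower p (isUpperSet_openConn a a₀)
      (isLowerSet_thresholdCut T a₀ hh) (hms _) (hms _)
  have hconn : μ.real (openConn a a₀ : Set (BondConfig (Fin n))) = 1 - δ a := by
    have := probReal_compl_eq_one_sub (μ := μ) (hms (openConn a a₀ : Set (BondConfig (Fin n))))
    simp only [hδ]; linarith
  have hδa : δ a ≤ M := hδle a ha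
  have hδa0 : 0 ≤ δ a := measureReal_nonneg
  have hK0 : 0 ≤ μ.real K := measureReal_nonneg
  have hB1 : M / (1 - M) ≤ 1 := by
    rw [div_le_one (by linarith)]; linarith
  have h1M : 0 < 1 - M := by linarith
  -- `(1 - M) · (M/(1-M)) = M`
  have hMid : (1 - M) * (M / (1 - M)) = M := by field_simp
  calc μ.real H ≤ μ.real ((openConn a a₀ : Set (BondConfig (Fin n)))ᶜ ∪ ((openConn a a₀ : Set (BondConfig (Fin n))) ∩ K)) :=
        measureReal_mono hsub
    _ ≤ μ.real (openConn a a₀ : Set (BondConfig (Fin n)))ᶜ + μ.real ((openConn a a₀ : Set (BondConfig (Fin n))) ∩ K) :=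
        measureReal_union_le _ _
    _ ≤ δ a + (1 - δ a) * μ.real K := by rw [← hconn]; exact add_le_add le_rfl hHarris
    _ ≤ δ a + (1 - δ a) * (M / (1 - M)) := by nlinarith [hKb, hδa, hbig']
    _ ≤ M + (1 - M) * (M / (1 - M)) := by nlinarith [hB1, hδa, hM0, hK0]
    _ = 2 * M := by rw [hMid]; ring

end HubOnly

end Summit.CriticalPhenomena.PercolationContinuityZ3.Theorems

end
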